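import Summits.QuantumFields.YangMills.Theorems.NPointIsotropy.Negative.TieLoadBearing
import Summits.QuantumFields.YangMills.Theorems.NPointIsotropy.Negative.DegreeTwoFree
import Summits.QuantumFields.YangMills.Theorems.CurvatureBoostCovariance.Negative.Unbundled
import Summits.QuantumFields.YangMills.Theorems.PencilRigidityNPointIsotropyBandlimit
import Literature.MathematicalPhysics.QuantumFieldTheory.OSLorentzInvariance

/-!
# Line `complex-rotation-bandlimit` — LEAD's skeleton (generation 3) for crux `PencilRigidity.NPointIsotropy`
(stmt-QuantumFields-11686; lead prover `prover-line-stmt-QuantumFields-11686-0`; `Cruxes/NPointIsotropy/PICKED.md`)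

REGISTRATION NOTE (to every other seat): from the pick (2026-08-16T01:27Z) the LEAD owns the skeleton and its
registration (`ledger skeleton check … --crux stmt-QuantumFields-11686`, last writer wins). Please do NOT re-register a
skeleton on this item — it silently replaces the stub signatures the stub workers are proving and bounces their
`--supports` proposals (`supports.stub-mismatch`, as happened to p74649 / p75124 when generation 2 was registered over
the lead's r1 at 01:47Z). Send reshapes as `Lines/<slug>.gen<k>.lean` / evidence notes instead; the lead folds them in.

Generation 3 = the planner's generation-2 skeleton (commit a12c588a6ea1; gen-2 deltas adopted verbatim: FUNCTION residual
`NPointRegular` for Step 0, explicit cone stub, exponential type uniform in `F`, band-limit degree uniform in `F`,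
explicit-degree Paley–Wiener, a.e. mop-up) with ONE change of form: every stub signature is SPELLED over importable
tree vocabulary only (`SchwingerFamily`, `IsOffDiagonal`, `coincidenceLocus`, `linActMulti`, `planeRot`, the landed
`Negative.E4` / `Negative.RadialKernel`, and the landed unbundling `OSPackage Translations Hypercubic EightFrameRP
PlanarCone PlanarInvariant W1` of `Theorems/CurvatureBoostCovariance/Negative/Unbundled.lean`), with the line-local
predicates of the planner's file UNFOLDED in place and each statement wrapped in its own `open … in`, because a stub
worker's `Theorems/` file must state the registered signature byte-for-byte and cannot import `Cruxes/…/Lines/*.lean`.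

GLOSSARY (planner's gen-2 names ↔ the unfolded text below):
* `NPointRegular S₁` ↔ `∀ n, ∃ W, ∀ F, IsOffDiagonal F → Integrable (fun x : Fin n → E4 => W x * F x) ∧
  S₁ n F = ∫ x : Fin n → E4, W x * F x` (every `𝔖ₙ|⁰𝒮` is a FUNCTION — the Step-0 residual; junk violates it:
  landed `Negative.not_nPointRegular_junk`, p75204).
* `planarRot θ` ↔ `planeRot (d := 3) 0 θ`.
* `IsPlanarGeneric F` ↔ `∀ x ∈ tsupport F, ∀ φ, (∀ i j, i ≠ j → (planeRot 0 φ (x i)) 0 ≠ (planeRot 0 φ (x j)) 0) ∨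
  (∀ i j, i ≠ j → (planeRot 0 φ (x i)) 1 ≠ (planeRot 0 φ (x j)) 1)`.
* `AngularBandLimited S₁` ↔ `∀ n, ∃ K : ℕ, ∀ F, IsOffDiagonal F → HasCompactSupport F → IsPlanarGeneric F →
  ∃ c, ∀ θ, S₁ n (R_θ·F) = ∑ k ∈ Icc (-K) K, c k * exp (4 k θ I)` (degree uniform in `F`).
* `GenericPlanarInvariant S₁` ↔ `∀ θ n F, IsOffDiagonal F → HasCompactSupport F → IsPlanarGeneric F → S₁ n (R_θ·F) = S₁ n F`.

STATUS OF THE SIX STUBS (the only `sorry`s of this file are open stubs):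
* `stub_tieRegularity` — USES THE TIE (every order) ⇒ function residual. OPEN (worker verdict 02:1xZ: not provable from
  the tree, not cheaply false; n = 0, 2 checked; the block is exactly n ≥ 3 = n-point UV regularity of the tied Wilson
  limit; candidate for promote-stub).
* `stub_planarCone`    — = `MirrorModularBoosts.PlanarSpectralCone` (stmt-9664) verbatim (`stub_planarCone_iff`). OPEN (own seat).
* `stub_entire`        — analytic engine. OPEN (worker verdict: blocked on the cone in MULTI-SLOT operator form + an
  OS-II multi-slot tower without E1; n ≤ 1 fine; no cheap falsity at n = 2).
* `stub_bandlimit`     — CLOSED: landed `Theorems/PencilRigidityNPointIsotropyBandlimit.lean` (p75205, ACCEPTED).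
* `stub_harmonicKill`  — THE BET (held by the lead). OPEN.
* `stub_mopup`         — PROVED by a worker (a.e. route, function residual); landing in progress (helpers file first).
`NPointIsotropy_of` composes the six into the crux BY NAME (pure logic).
-/

noncomputable section

-- Mathlib's `SimplexCategory` instance `Fintype (Fin (x.len + 1))` matches `Fintype (Fin 4)` and makes concrete `Fin 4` instance
-- paths diverge between elaborations (tree-known file-local workaround, as in the landed `Negative/*.lean` files of this crux).
attribute [-instance] SimplexCategory.instFintypeToTypeOrderHomFinHAddNatLenOfNat

namespace Summit.QuantumFields.YangMills.Cruxes.NPointIsotropy.ComplexRotationBandlimit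

open scoped BigOperators SchwartzMap
open MeasureTheory Filter Topology
open Literature.MathematicalPhysics.QuantumLattice Literature.MathematicalPhysics.AQFT
  Literature.MathematicalPhysics.QuantumFieldTheory
open Summit.QuantumFields.YangMills.Theorems.NPointIsotropy.Negative (E4 RadialKernel nPointIsotropy_iff
  not_NPointIsotropyModelBlind not_NPointIsotropyWithoutTieAt4 radialKernel_invariant_two)
open Summit.QuantumFields.YangMills.Theorems.CurvatureBoostCovariance.Negative
  (OSPackage Translations Hypercubic EightFrameRP PlanarCone PlanarInvariant Tie Gaps W1)

/-! ## The six stubs (statements over importable vocabulary only; each wrapped in its own `open … in`) -/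

/-- **Stub 1 — Step 0, the stub that USES THE TIE (difficulty XL; a property of the Wilson limit, like crux #4
`CurvatureKernelBound`).** For every compact simple `G` (any Borel structure; the crux instantiates `borel G`),
lattice representation `r`, scheme `sch` and one-species family `S₁` with the curvature package `W1 r sch S₁`
(tie at EVERY order, OS package, translations, proper hypercubic invariance, both gaps), the eight planar frames
and the radial kernel: every `𝔖ₙ|⁰𝒮` is a FUNCTION (the gen-2 residual `NPointRegular`, unfolded). Honours
`not_NPointIsotropyWithoutTieAt4` / `not_NPointIsotropyWithoutTie`; certified inhabitants (`c ≡ 0`: `Wₙ = 0`;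
`β_k = 0` frequently: `Wₙ = κⁿ`; vacuum) satisfy it; junk violates it (`Negative.not_nPointRegular_junk`). Mechanism and
the planner's slab-rigidity analysis: line card `Lines/complex-rotation-bandlimit.md` (gen 2) + Appendix A. Worker
verdict (wave 1): not provable from the tree (the tie pins `S₁ n|⁰𝒮` only as an uncharacterised limit; no lattice RP
for odd tori, no passage of unordered RP through the tie, no finite-frame n-point OS-II analyticity theorem), not
cheaply false; the block is exactly `n ≥ 3`. -/
theorem stub_tieRegularity :
    open Literature.MathematicalPhysics.QuantumLattice Literature.MathematicalPhysics.AQFT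
      Literature.MathematicalPhysics.QuantumFieldTheory
      Summit.QuantumFields.YangMills.Theorems.CurvatureBoostCovariance.Negative
      Summit.QuantumFields.YangMills.Theorems.NPointIsotropy.Negative in
    ∀ (G : Type) [Group G] [TopologicalSpace G] [IsTopologicalGroup G] [CompactSpace G]
      [MeasurableSpace G] [BorelSpace G], IsCompactSimpleLieGroup G →
      ∀ (r : LatticeRep G) (sch : SpeciesScheme (YMSpecies G)) (S₁ : SchwingerFamily E4),
        W1 r sch S₁ → EightFrameRP S₁ → RadialKernel S₁ →
        ∀ n : ℕ, ∃ W : (Fin n → E4) → ℂ, ∀ F : SchwartzMap (Fin n → E4) ℂ, IsOffDiagonal F →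
          MeasureTheory.Integrable (fun x : Fin n → E4 => W x * F x) ∧
            S₁ n F = ∫ x : Fin n → E4, W x * F x := by
  sorry

/-- **Stub 2 — the planar spectral cone (difficulty L; = the shared model-blind item stmt-QuantumFields-9664
`MirrorModularBoosts.PlanarSpectralCone` VERBATIM, see `stub_planarCone_iff`; staffed on its own seat).** E0' + E3 +
translations + E2 in the eight planar frames ⇒ the planar cone `PlanarCone S₁` (joint holomorphy of
`(t,b) ↦ 𝔖(ΘF* ⊗ G_{(t e₀ + b e₁)})` on `{|Im b| < Re t}` with the contraction bound). Consumed by stubs 3 and 5. -/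
theorem stub_planarCone :
    open Literature.MathematicalPhysics.QuantumLattice Literature.MathematicalPhysics.AQFT
      Summit.QuantumFields.YangMills.Theorems.CurvatureBoostCovariance.Negative
      Summit.QuantumFields.YangMills.Theorems.NPointIsotropy.Negative in
    ∀ S₁ : SchwingerFamily E4, S₁.toLabelled.HasLinearGrowth → S₁.toLabelled.IsSymmetric →
      Translations S₁ → EightFrameRP S₁ → PlanarCone S₁ := by
  sorry

/-- **Stub 3 — the analytic engine (model-blind; difficulty XL; shape of ideator 2's `Sketch.EntireComplexAngle`).**
For a one-species family with E0', E3, translation and proper hypercubic invariance on `⁰𝒮`, E2 in the eight planar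
frames and the planar cone, and for every degree `n`, there is an exponential TYPE `N = N(S₁,n)` such that for every
compactly supported planar-generic off-diagonal `F` the orbit function `θ ↦ 𝔖ₙ(planeRot 0 θ · F)` is the restriction
to `ℝ` of an entire `π/2`-periodic `Φ` with `‖Φ z‖ ≤ C e^{N |Im z|}`. Mechanism (i)–(v) in the line card. Worker verdict
(wave 1): blocked on the cone in MULTI-SLOT operator form (`spec(H,P₁) ⊂ {E ≥ |p₁|}` on the `e₀`- and `e₁`-frame OS
spaces) and an OS-II multi-slot continuation WITHOUT E1 (tree's `OS1975_exists_timeContinuation` needs `IsOSFamily`);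
n ≤ 1 provable now; no cheap falsity at n = 2 (for `Ĉ = 1/Ψ(p)`, RP along `e₀` and `(e₀+e₁)/√2` force `Ψ = Ψ(p²)`). -/
theorem stub_entire :
    open Literature.MathematicalPhysics.QuantumLattice Literature.MathematicalPhysics.AQFT
      Literature.MathematicalPhysics.QuantumFieldTheory
      Summit.QuantumFields.YangMills.Theorems.CurvatureBoostCovariance.Negative
      Summit.QuantumFields.YangMills.Theorems.NPointIsotropy.Negative in
    ∀ (S₁ : SchwingerFamily E4), S₁.toLabelled.HasLinearGrowth → S₁.toLabelled.IsSymmetric →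
      Translations S₁ → Hypercubic S₁ → EightFrameRP S₁ → PlanarCone S₁ →
      ∀ n : ℕ, ∃ N : ℝ, ∀ F : SchwartzMap (Fin n → E4) ℂ, IsOffDiagonal F →
        HasCompactSupport (F : (Fin n → E4) → ℂ) →
        (∀ x ∈ tsupport (F : (Fin n → E4) → ℂ), ∀ φ : ℝ,
          (∀ i j : Fin n, i ≠ j → (planeRot (d := 3) 0 φ (x i)) 0 ≠ (planeRot (d := 3) 0 φ (x j)) 0) ∨
          (∀ i j : Fin n, i ≠ j → (planeRot (d := 3) 0 φ (x i)) 1 ≠ (planeRot (d := 3) 0 φ (x j)) 1)) →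
        ∃ (Φ : ℂ → ℂ) (C : ℝ), Differentiable ℂ Φ ∧
          (∀ θ : ℝ, Φ θ = S₁ n (linActMulti (planeRot (d := 3) 0 θ) F)) ∧
          (∀ z : ℂ, Φ (z + (Real.pi / 2 : ℝ)) = Φ z) ∧
          (∀ z : ℂ, ‖Φ z‖ ≤ C * Real.exp (N * |z.im|)) := by
  sorry

/-- **Stub 4 — angular Paley–Wiener (CLOSED).** An entire `π/2`-periodic function with `‖Φ z‖ ≤ C e^{N|Im z|}` is a
trigonometric polynomial in `e^{4iθ}` of degree `≤ K` whenever `N < 4(K+1)`. LANDED by a stub worker of this line: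
`Theorems/PencilRigidityNPointIsotropyBandlimit.lean` (p75205; rectangle contour shift + Fourier series on
`AddCircle (π/2)`), imported here. -/
theorem stub_bandlimit :
    ∀ (Φ : ℂ → ℂ) (C N : ℝ) (K : ℕ), Differentiable ℂ Φ →
      (∀ z : ℂ, Φ (z + (Real.pi / 2 : ℝ)) = Φ z) →
      (∀ z : ℂ, ‖Φ z‖ ≤ C * Real.exp (N * |z.im|)) →
      N < 4 * ((K : ℝ) + 1) →
      ∃ c : ℤ → ℂ, ∀ θ : ℝ,
        Φ θ = ∑ k ∈ Finset.Icc (-(K : ℤ)) K, c k * Complex.exp (4 * (k : ℂ) * (θ : ℂ) * Complex.I) :=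
  Summit.QuantumFields.YangMills.Theorems.NPointIsotropy.ComplexRotationBandlimit.stub_bandlimit

/-- **Stub 5 — THE FINITE HARMONIC KILL, the bet of the line (hardest; difficulty XL; held by the lead).** For a
one-species family with the OS package, translations, proper hypercubic invariance, a mass gap, E2 in the eight
planar frames, the planar cone, a RADIAL continuous two-point kernel and every `𝔖ₙ|⁰𝒮` a function, whose orbit
functions on compactly supported planar-generic test functions are band-limited with a degree `K(n)` uniform in
`F`: every anisotropic isotypic component vanishes — `𝔖ₙ(R_θ·F) = 𝔖ₙ(F)` on generic supports. Degrees `≤ 2` hold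
outright (`n = 2`: landed `Negative.DegreeTwoFree.radialKernel_invariant_two`; `n = 1`: translations + function
residual; `n = 0`: trivial). Honest status: the REGULAR MODEL-BLIND CORE in band-limited dress; the disprover's
cycle-3 §11 (Borchers-class no-go) shows its named falsifier class — local Wick polynomials of reflection-positive
generalised free fields with radial `⟨ss⟩` — is EMPTY (such `s` are `SO(4)`-scalars mod null), so a counterexample
must leave the Borchers class of GFFs; no proof idea beyond GFFs is on record (Gaier–Yngvason 2000). -/
theorem stub_harmonicKill :
    open Literature.MathematicalPhysics.QuantumLattice Literature.MathematicalPhysics.AQFT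
      Literature.MathematicalPhysics.QuantumFieldTheory
      Summit.QuantumFields.YangMills.Theorems.CurvatureBoostCovariance.Negative
      Summit.QuantumFields.YangMills.Theorems.NPointIsotropy.Negative in
    ∀ (S₁ : SchwingerFamily E4), OSPackage S₁ → Translations S₁ → Hypercubic S₁ →
      (∃ Δ : ℝ, 0 < Δ ∧ S₁.toLabelled.HasMassGap Δ) → EightFrameRP S₁ → PlanarCone S₁ → RadialKernel S₁ →
      (∀ n : ℕ, ∃ W : (Fin n → E4) → ℂ, ∀ F : SchwartzMap (Fin n → E4) ℂ, IsOffDiagonal F →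
        MeasureTheory.Integrable (fun x : Fin n → E4 => W x * F x) ∧
          S₁ n F = ∫ x : Fin n → E4, W x * F x) →
      (∀ n : ℕ, ∃ K : ℕ, ∀ F : SchwartzMap (Fin n → E4) ℂ, IsOffDiagonal F →
        HasCompactSupport (F : (Fin n → E4) → ℂ) →
        (∀ x ∈ tsupport (F : (Fin n → E4) → ℂ), ∀ φ : ℝ,
          (∀ i j : Fin n, i ≠ j → (planeRot (d := 3) 0 φ (x i)) 0 ≠ (planeRot (d := 3) 0 φ (x j)) 0) ∨
          (∀ i j : Fin n, i ≠ j → (planeRot (d := 3) 0 φ (x i)) 1 ≠ (planeRot (d := 3) 0 φ (x j)) 1)) →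
        ∃ c : ℤ → ℂ, ∀ θ : ℝ,
          S₁ n (linActMulti (planeRot (d := 3) 0 θ) F) =
            ∑ k ∈ Finset.Icc (-(K : ℤ)) K, c k * Complex.exp (4 * (k : ℂ) * (θ : ℂ) * Complex.I)) →
      ∀ (θ : ℝ) (n : ℕ) (F : SchwartzMap (Fin n → E4) ℂ), IsOffDiagonal F →
        HasCompactSupport (F : (Fin n → E4) → ℂ) →
        (∀ x ∈ tsupport (F : (Fin n → E4) → ℂ), ∀ φ : ℝ,
          (∀ i j : Fin n, i ≠ j → (planeRot (d := 3) 0 φ (x i)) 0 ≠ (planeRot (d := 3) 0 φ (x j)) 0) ∨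
          (∀ i j : Fin n, i ≠ j → (planeRot (d := 3) 0 φ (x i)) 1 ≠ (planeRot (d := 3) 0 φ (x j)) 1)) →
        S₁ n (linActMulti (planeRot (d := 3) 0 θ) F) = S₁ n F := by
  sorry

/-- **Stub 6 — mop-up (model-blind given Step 0; difficulty M; PROVED by a stub worker, landing in progress).** If
every `𝔖ₙ|⁰𝒮` is integration against a function `Wₙ` and `S₁` is planar-invariant on generic compact supports, then
`S₁` is planar-invariant on all of `⁰𝒮`: every determinant-one isometry fixing `e₂, e₃` is `planeRot 0 θ`
(explicit 4×4 Laplace expansion of the determinant); `𝔖ₙ(R·F) = ∫ Wₙ·(R·F) = ∫ (Wₙ∘R)·F` (Lebesgue measure on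
`(ℝ⁴)ⁿ` is `R`-invariant; `R·F ∈ ⁰𝒮`); there is an OPEN set `G ⊆ (coincidence locus)ᶜ` with `volume Gᶜ = 0`
(complement = finite union of null quadrics `⟪π(xᵢ-xⱼ), π(x_k-x_l)⟫ = 0`, Fubini via `lmarginal`) on which every
supported test function is planar-generic; truncating `F` by a smooth exhaustion `χ_k ↑ 1_G` and dominated
convergence against the `L¹` density give `∫ (Wₙ∘R - Wₙ)·F = lim ∫ (Wₙ∘R - Wₙ)·(χ_k F) = 0`. No continuity, density
or du Bois-Reymond step is needed. False without Step 0 (`Negative.PlanarGenericJunk.planar_generic_not_determining`). -/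
theorem stub_mopup :
    open Literature.MathematicalPhysics.QuantumLattice Literature.MathematicalPhysics.AQFT
      Literature.MathematicalPhysics.QuantumFieldTheory
      Summit.QuantumFields.YangMills.Theorems.CurvatureBoostCovariance.Negative
      Summit.QuantumFields.YangMills.Theorems.NPointIsotropy.Negative in
    ∀ (S₁ : SchwingerFamily E4),
      (∀ n : ℕ, ∃ W : (Fin n → E4) → ℂ, ∀ F : SchwartzMap (Fin n → E4) ℂ, IsOffDiagonal F →
        MeasureTheory.Integrable (fun x : Fin n → E4 => W x * F x) ∧
          S₁ n F = ∫ x : Fin n → E4, W x * F x) →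
      (∀ (θ : ℝ) (n : ℕ) (F : SchwartzMap (Fin n → E4) ℂ), IsOffDiagonal F →
        HasCompactSupport (F : (Fin n → E4) → ℂ) →
        (∀ x ∈ tsupport (F : (Fin n → E4) → ℂ), ∀ φ : ℝ,
          (∀ i j : Fin n, i ≠ j → (planeRot (d := 3) 0 φ (x i)) 0 ≠ (planeRot (d := 3) 0 φ (x j)) 0) ∨
          (∀ i j : Fin n, i ≠ j → (planeRot (d := 3) 0 φ (x i)) 1 ≠ (planeRot (d := 3) 0 φ (x j)) 1)) →
        S₁ n (linActMulti (planeRot (d := 3) 0 θ) F) = S₁ n F) →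
      PlanarInvariant S₁ := by
  sorry

/-! ## Checks against the landed negative / positive knowledge (imports live; sorry-free) -/

/-- Stub 2 is literally the shared item `MirrorModularBoosts.PlanarSpectralCone` (stmt-QuantumFields-9664). -/
theorem stub_planarCone_iff :
    (∀ S₁ : SchwingerFamily E4, S₁.toLabelled.HasLinearGrowth → S₁.toLabelled.IsSymmetric →
        Translations S₁ → EightFrameRP S₁ → PlanarCone S₁) ↔
      Summit.QuantumFields.YangMills.Theses.MirrorModularBoosts.PlanarSpectralCone :=
  Iff.rfl

/-- The model-blind form of the crux (both lattice clauses dropped) is FALSE (junk family, file IV): no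
rearrangement of stubs 2–6 may conclude `PlanarInvariant` without the Step-0 residual. -/
example : ¬ Summit.QuantumFields.YangMills.Theorems.NPointIsotropy.Negative.NPointIsotropyModelBlind :=
  not_NPointIsotropyModelBlind

/-- The tie AT ORDER 4 (file V) is load-bearing: Step 0 consumes `W1` whole. -/
example : ¬ Summit.QuantumFields.YangMills.Theorems.NPointIsotropy.Negative.NPointIsotropyWithoutTieAt4 :=
  not_NPointIsotropyWithoutTieAt4

/-- Degree `2` of the kill is free from the radial kernel alone (file IX), for EVERY linear isometry. -/
example {S₁ : SchwingerFamily E4} (hK : RadialKernel S₁) (R : E4 ≃ₗᵢ[ℝ] E4) (F : 𝓢((Fin 2 → E4), ℂ))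
    (hF : IsOffDiagonal F) : S₁ 2 (linActMulti R F) = S₁ 2 F :=
  radialKernel_invariant_two hK R F hF

/-! ## Composition: the six stubs prove the crux BY NAME (pure logic) -/

/-- **What the model-blind stubs 2–6 prove on their own**: the regular model-blind form with the FUNCTION residual
(OS package + translations + hypercubic + gap + eight frames + radial kernel + every `𝔖ₙ|⁰𝒮` a function ⇒
`PlanarInvariant`) — junk-proof by the residual, no counterexample known; Step 0 (`stub_tieRegularity`) is the only
place the lattice enters. -/
theorem regularModelBlind_of_stubs (S₁ : SchwingerFamily E4) (hOS : OSPackage S₁) (htr : Translations S₁)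
    (hhyp : Hypercubic S₁) (hgap : ∃ Δ : ℝ, 0 < Δ ∧ S₁.toLabelled.HasMassGap Δ) (h8 : EightFrameRP S₁)
    (hK : RadialKernel S₁)
    (hreg : ∀ n : ℕ, ∃ W : (Fin n → E4) → ℂ, ∀ F : 𝓢((Fin n → E4), ℂ), IsOffDiagonal F →
      MeasureTheory.Integrable (fun x : Fin n → E4 => W x * F x) ∧ S₁ n F = ∫ x : Fin n → E4, W x * F x) :
    PlanarInvariant S₁ := by
  have hcone : PlanarCone S₁ := stub_planarCone S₁ hOS.2.2.1 hOS.2.2.2.2.1 htr h8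
  refine stub_mopup S₁ hreg (stub_harmonicKill S₁ hOS htr hhyp hgap h8 hcone hK hreg fun n => ?_)
  -- stubs 3 + 4: the angular band limit with uniform degree `K(n) = ⌊N(n)/4⌋₊`
  obtain ⟨N, hN⟩ := stub_entire S₁ hOS.2.2.1 hOS.2.2.2.2.1 htr hhyp h8 hcone n
  refine ⟨⌊N / 4⌋₊, fun F hF hFc hgen => ?_⟩
  obtain ⟨Φ, C, hΦd, hΦeq, hΦper, hΦbd⟩ := hN F hF hFc hgen
  have hK' : N < 4 * ((⌊N / 4⌋₊ : ℝ) + 1) := by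
    have := Nat.lt_floor_add_one (N / 4)
    linarith
  obtain ⟨c, hc⟩ := stub_bandlimit Φ C N ⌊N / 4⌋₊ hΦd hΦper hΦbd hK'
  exact ⟨c, fun θ => by rw [← hΦeq θ]; exact hc θ⟩

/-- **The skeleton**: `stub_tieRegularity`, `stub_planarCone`, `stub_entire`, `stub_bandlimit`, `stub_harmonicKill`,
`stub_mopup` prove `PencilRigidity.NPointIsotropy` (concluded by name; the only sorries are the open stubs). -/
theorem NPointIsotropy_of : Summit.QuantumFields.YangMills.Theses.PencilRigidity.NPointIsotropy := by
  rw [nPointIsotropy_iff]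
  intro G _ _ _ _ hG
  letI : MeasurableSpace G := borel G
  haveI : BorelSpace G := ⟨rfl⟩
  intro r sch S₁ hW h8 hK
  -- Step 0 (the tie, Borel σ-algebra as in the crux): every 𝔖ₙ|⁰𝒮 of the tied family is a function
  have hreg := stub_tieRegularity G hG r sch S₁ hW h8 hK
  obtain ⟨-, hOS, htr, hhyp, hgaps⟩ := hW
  have hgap : ∃ Δ : ℝ, 0 < Δ ∧ S₁.toLabelled.HasMassGap Δ := by
    obtain ⟨Δ, hΔ, hgap, -⟩ := hgaps
    exact ⟨Δ, hΔ, hgap⟩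
  -- stubs 2–6: the regular model-blind form
  exact regularModelBlind_of_stubs S₁ hOS htr hhyp hgap h8 hK hreg

end Summit.QuantumFields.YangMills.Cruxes.NPointIsotropy.ComplexRotationBandlimit

end
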